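import Summits.NavierStokesRegularity.NavierStokesRegularity.Theorems.HubbleDynamoNoSelfExcitedDynamoStubBackwardGronwall
import HarnessLib

/-!
# Crux `HubbleDynamo.NoSelfExcitedDynamo` (stmt-NavierStokesRegularity-1934), line `registered`:
# stub `stub_enstrophyBootstrapODE` — the enstrophy bootstrap ODE (forward decay below the floor)

Helper file (`--supports stmt-NavierStokesRegularity-1934`; theorems only, sorry-free). PURE REAL
ANALYSIS. Let `E, D, S : ℝ → ℝ` with `E` continuous, `0 ≤ E ≤ M`, `0 ≤ D`, the stretching bound
`S⁴ ≤ k E³ D³` (`k ≥ 0`) and the evolution identity `E(s₁) − E(s₀) = 2∫_{s₀}^{s₁}(S − D − ¼E)` for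
`s₀ ≤ s₁` (with an interval-integrable integrand). If `k E(s₀)² < ½` at one time `s₀`, then
`E(s) → 0` as `s → +∞`, stated uniformly: for every `ε > 0` there is `T` with `E(s) < ε` for `s ≥ T`.

In the line, `E` is the enstrophy of an eternal profile-class solution of Leray's backward system in
similarity time, `D` its palinstrophy and `S` the vortex-stretching integral; this stub is the forward
half of the enstrophy floor.

## Proof

* `bootstrap_amgm`: weighted AM–GM in polynomial form, `x⁴ ≤ a d³`, `a, d ≥ 0 ⟹ x ≤ (a + 3d)/4`,
  from the identity `(a + 3d)⁴ − 256 a d³ = (a − d)²((a + 7d)² + 32d²) ≥ 0`.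
* `bootstrap_integrand_le`: with `a = k E³`, `d = D` this gives `S ≤ (k E² · E + 3D)/4`, hence the
  integrand obeys `S − D − ¼E ≤ −⅛E` wherever `k E² ≤ ½`.
* `bootstrap_increment_le`: on an interval `[a, b]` on whose interior `k E² ≤ ½`, the identity and
  monotonicity of the interval integral give `E(b) − E(a) ≤ −¼ ∫_a^b E (≤ 0)`.
* `bootstrap_trap` (first-exit argument): the closed set `{t ≥ s₀ | ½ ≤ k E(t)²}`, if nonempty, has a
  least element `t₁ > s₀`; on `(s₀, t₁)` one has `k E² < ½`, so `E(t₁) ≤ E(s₀)` and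
  `k E(t₁)² ≤ k E(s₀)² < ½`, absurd. Hence `k E² < ½` on `[s₀, ∞)`.
* `bootstrap_linear_bound`: therefore `E` is non-increasing on `[s₀, ∞)` and
  `E(b) − E(s₀) ≤ −¼ ∫_{s₀}^b E ≤ −¼ (b − s₀) E(b)`, i.e. `(1 + (b − s₀)/4) E(b) ≤ E(s₀)`, which is
  `< ε (1 + (b − s₀)/4)` as soon as `b ≥ s₀ + 4 E(s₀)/ε + 1`.
-/

noncomputable section

-- the mandated stub namespace repeats `NavierStokesRegularity` (tree precedent for this crux's stubs)
set_option linter.dupNamespace false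

namespace Summit.NavierStokesRegularity.NavierStokesRegularity.Theorems.NoSelfExcitedDynamo.Registered

open Set MeasureTheory Filter Topology

/-- The polynomial inequality behind the weighted AM–GM inequality `a^{1/4} d^{3/4} ≤ (a + 3d)/4`:
`256 a d³ ≤ (a + 3d)⁴` for all real `a, d`, since the difference is `(a − d)²((a + 7d)² + 32d²)`. -/
theorem bootstrap_amgm_poly (a d : ℝ) : 256 * (a * d ^ 3) ≤ (a + 3 * d) ^ 4 := by
  nlinarith [mul_nonneg (sq_nonneg (a - d))
    (add_nonneg (sq_nonneg (a + 7 * d)) (mul_nonneg (by norm_num : (0 : ℝ) ≤ 32) (sq_nonneg d)))]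

/-- Weighted AM–GM in polynomial form: if `a, d ≥ 0` and `x⁴ ≤ a d³` then `x ≤ (a + 3d)/4`. -/
theorem bootstrap_amgm {a d x : ℝ} (ha : 0 ≤ a) (hd : 0 ≤ d) (hx : x ^ 4 ≤ a * d ^ 3) :
    x ≤ (a + 3 * d) / 4 := by
  have hm : 0 ≤ (a + 3 * d) / 4 := by positivity
  refine le_of_pow_le_pow_left₀ (by norm_num) hm (hx.trans ?_)
  have h := bootstrap_amgm_poly a d
  have h3 : ((a + 3 * d) / 4) ^ 4 = (a + 3 * d) ^ 4 / 256 := by ring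
  rw [h3, le_div_iff₀ (by norm_num : (0 : ℝ) < 256)]
  linarith

/-- Pointwise bound on the enstrophy integrand: if `x⁴ ≤ k e³ d³` with `k, e, d ≥ 0` and `k e² ≤ ½`,
then `x − d − ¼e ≤ −⅛e` (AM–GM gives `x ≤ (k e² · e + 3d)/4 ≤ (e/2 + 3d)/4`). -/
theorem bootstrap_integrand_le {k e d x : ℝ} (hk : 0 ≤ k) (he : 0 ≤ e) (hd : 0 ≤ d)
    (hx : x ^ 4 ≤ k * e ^ 3 * d ^ 3) (hke : k * e ^ 2 ≤ 1 / 2) :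
    x - d - (1 / 4) * e ≤ -(1 / 8) * e := by
  have h1 : x ≤ (k * e ^ 3 + 3 * d) / 4 := bootstrap_amgm (mul_nonneg hk (pow_nonneg he 3)) hd hx
  have h2 : k * e ^ 3 ≤ 1 / 2 * e := by
    have h3 : k * e ^ 3 = k * e ^ 2 * e := by ring
    rw [h3]
    exact mul_le_mul_of_nonneg_right hke he
  linarith

/-- Increment bound. Under the standing hypotheses of the stub (`k ≥ 0`, `E` continuous and
nonnegative, `D ≥ 0`, `S⁴ ≤ k E³ D³`, and the evolution identity with interval-integrable
integrand), on every interval `a ≤ b` on whose interior `k E² ≤ ½` one has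
`E b − E a ≤ −¼ ∫_a^b E`. -/
theorem bootstrap_increment_le {E D S : ℝ → ℝ} {k : ℝ} (hk : 0 ≤ k) (hE : Continuous E)
    (hE0 : ∀ s, 0 ≤ E s) (hD0 : ∀ s, 0 ≤ D s) (hS : ∀ s, S s ^ 4 ≤ k * E s ^ 3 * D s ^ 3)
    (hid : ∀ s₀ s₁ : ℝ, s₀ ≤ s₁ →
      IntervalIntegrable (fun s => S s - D s - (1 / 4) * E s) volume s₀ s₁ ∧
      E s₁ - E s₀ = 2 * ∫ s in s₀..s₁, (S s - D s - (1 / 4) * E s))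
    {a b : ℝ} (hab : a ≤ b) (hsmall : ∀ u ∈ Ioo a b, k * E u ^ 2 ≤ 1 / 2) :
    E b - E a ≤ -(1 / 4) * ∫ s in a..b, E s := by
  obtain ⟨hint, heq⟩ := hid a b hab
  have hcont : Continuous fun s => -(1 / 8) * E s := by fun_prop
  have hmono : (∫ s in a..b, (S s - D s - (1 / 4) * E s)) ≤ ∫ s in a..b, -(1 / 8) * E s :=
    intervalIntegral.integral_mono_on_of_le_Ioo hab hint (hcont.intervalIntegrable _ _)
      fun u hu => bootstrap_integrand_le hk (hE0 u) (hD0 u) (hS u) (hsmall u hu)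
  rw [intervalIntegral.integral_const_mul] at hmono
  linarith

/-- First-exit (continuity) argument. Let `f` be continuous with `f s₀ < c`, and suppose that for
every `t ≥ s₀`, the bound `f ≤ c` on `(s₀, t)` forces `f t ≤ f s₀`. Then `f t < c` for all
`t ≥ s₀`: otherwise the closed set `{t ≥ s₀ | c ≤ f t}` has a least element `t₁`, on `(s₀, t₁)` one
has `f < c`, whence `c ≤ f t₁ ≤ f s₀ < c`. -/
theorem bootstrap_trap {f : ℝ → ℝ} {s₀ c : ℝ} (hf : Continuous f)
    (hdec : ∀ t, s₀ ≤ t → (∀ u ∈ Ioo s₀ t, f u ≤ c) → f t ≤ f s₀) (h0 : f s₀ < c) :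
    ∀ t, s₀ ≤ t → f t < c := by
  intro t ht
  by_contra hcon
  push Not at hcon
  have hclosed : IsClosed {t : ℝ | s₀ ≤ t ∧ c ≤ f t} :=
    (isClosed_le continuous_const continuous_id).and (isClosed_le continuous_const hf)
  have hne : ({t : ℝ | s₀ ≤ t ∧ c ≤ f t}).Nonempty := ⟨t, ht, hcon⟩
  have hbdd : BddBelow {t : ℝ | s₀ ≤ t ∧ c ≤ f t} := ⟨s₀, fun u hu => hu.1⟩
  have hmem := hclosed.csInf_mem hne hbdd
  have hIoo : ∀ u ∈ Ioo s₀ (sInf {t : ℝ | s₀ ≤ t ∧ c ≤ f t}), f u ≤ c := by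
    intro u hu
    by_contra hu'
    exact (not_le.mpr hu.2) (csInf_le hbdd ⟨hu.1.le, (not_le.mp hu').le⟩)
  have h1 := hdec _ hmem.1 hIoo
  exact (lt_irrefl c) ((hmem.2.trans h1).trans_lt h0)

/-- If `E ≥ 0` satisfies `E b − E a ≤ −¼ ∫_a^b E` for all `s₀ ≤ a ≤ b`, then `E` is non-increasing on
`[s₀, ∞)` (the interval integral of a pointwise nonnegative function over `a ≤ b` is nonnegative,
whatever its integrability). -/
theorem bootstrap_antitoneOn (E : ℝ → ℝ) (s₀ : ℝ) (hE0 : ∀ s, 0 ≤ E s)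
    (hinc : ∀ a b, s₀ ≤ a → a ≤ b → E b - E a ≤ -(1 / 4) * ∫ s in a..b, E s) :
    AntitoneOn E (Ici s₀) := by
  intro a ha b _ hab
  have hint : 0 ≤ ∫ s in a..b, E s := intervalIntegral.integral_nonneg hab fun u _ => hE0 u
  have h := hinc a b ha hab
  linarith

/-- Linear-in-time decay. If `E ≥ 0` is continuous and `E b − E a ≤ −¼ ∫_a^b E` for all
`s₀ ≤ a ≤ b`, then `(1 + (b − s₀)/4) E b ≤ E s₀` for every `b ≥ s₀`: `E` is non-increasing on
`[s₀, ∞)`, so `(b − s₀) E b ≤ ∫_{s₀}^b E ≤ 4 (E s₀ − E b)`. -/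
theorem bootstrap_linear_bound (E : ℝ → ℝ) (s₀ : ℝ) (hE : Continuous E) (hE0 : ∀ s, 0 ≤ E s)
    (hinc : ∀ a b, s₀ ≤ a → a ≤ b → E b - E a ≤ -(1 / 4) * ∫ s in a..b, E s) {b : ℝ}
    (hb : s₀ ≤ b) : E b * (1 + (b - s₀) / 4) ≤ E s₀ := by
  have hanti := bootstrap_antitoneOn E s₀ hE0 hinc
  have h1 : (b - s₀) * E b ≤ ∫ s in s₀..b, E s := by
    have h2 : ∫ _ in s₀..b, E b = (b - s₀) * E b := by
      simp only [intervalIntegral.integral_const, smul_eq_mul]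
    rw [← h2]
    exact intervalIntegral.integral_mono_on hb intervalIntegrable_const (hE.intervalIntegrable _ _)
      fun u hu => hanti (mem_Ici.2 hu.1) (mem_Ici.2 hb) hu.2
  have h3 := hinc s₀ b le_rfl hb
  linarith

/-- **Stub `stub_enstrophyBootstrapODE`** (the enstrophy bootstrap ODE; pure real analysis). Let
`E, D, S : ℝ → ℝ` with `E` continuous, `0 ≤ E ≤ M`, `0 ≤ D`, the stretching bound `S⁴ ≤ k E³ D³`
(`k ≥ 0`) and the evolution identity `E(s₁) − E(s₀) = 2∫_{s₀}^{s₁}(S − D − ¼E)` for `s₀ ≤ s₁`. If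
`k E(s₀)² < ½` at one time `s₀`, then `E(s) → 0` as `s → +∞`: AM–GM turns the stretching bound into
`S ≤ (kE³ + 3D)/4`, so the integrand is `≤ ¼E(kE² − 1) − ¼D ≤ −⅛E` wherever `kE² ≤ ½`
(`bootstrap_integrand_le`); a first-exit argument keeps `kE² < ½` on `[s₀, ∞)` (`bootstrap_trap`),
whence `E` is non-increasing there and `(1 + (s − s₀)/4) E(s) ≤ E(s₀)` (`bootstrap_linear_bound`). -/
theorem stub_enstrophyBootstrapODE :
    ∀ (E D S : ℝ → ℝ) (k M : ℝ), 0 ≤ k → Continuous E → (∀ s, 0 ≤ E s) → (∀ s, E s ≤ M) →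
      (∀ s, 0 ≤ D s) → (∀ s, S s ^ 4 ≤ k * E s ^ 3 * D s ^ 3) →
      (∀ s₀ s₁ : ℝ, s₀ ≤ s₁ →
        IntervalIntegrable (fun s => S s - D s - (1 / 4) * E s) volume s₀ s₁ ∧
        E s₁ - E s₀ = 2 * ∫ s in s₀..s₁, (S s - D s - (1 / 4) * E s)) →
      ∀ s₀ : ℝ, k * E s₀ ^ 2 < 1 / 2 →
      ∀ ε : ℝ, 0 < ε → ∃ T : ℝ, ∀ s, T ≤ s → E s < ε := by
  intro E D S k M hk hE hE0 _hM hD0 hS hid s₀ hs₀ ε hε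
  -- (3) the smallness `k E² < 1/2` persists on `[s₀, ∞)` (first-exit argument)
  have hsmall : ∀ t, s₀ ≤ t → k * E t ^ 2 < 1 / 2 :=
    bootstrap_trap (f := fun t => k * E t ^ 2) (by fun_prop)
      (fun t ht h => by
        have h1 := bootstrap_increment_le hk hE hE0 hD0 hS hid ht h
        have h2 : 0 ≤ ∫ s in s₀..t, E s := intervalIntegral.integral_nonneg ht fun u _ => hE0 u
        have h3 : E t ≤ E s₀ := by linarith
        exact mul_le_mul_of_nonneg_left (pow_le_pow_left₀ (hE0 t) h3 2) hk)
      hs₀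
  -- (4) increments on `[s₀, ∞)`, monotonicity and the linear-in-time bound
  have hinc : ∀ a b, s₀ ≤ a → a ≤ b → E b - E a ≤ -(1 / 4) * ∫ s in a..b, E s :=
    fun a b ha hab => bootstrap_increment_le hk hE hE0 hD0 hS hid hab
      fun u hu => (hsmall u (ha.trans hu.1.le)).le
  refine ⟨s₀ + 4 * (E s₀ / ε) + 1, fun s hs => ?_⟩
  have hEε : 0 ≤ E s₀ / ε := div_nonneg (hE0 s₀) hε.le
  have hs₀s : s₀ ≤ s := by linarith
  have h1 := bootstrap_linear_bound E s₀ hE hE0 hinc hs₀s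
  by_contra hcon
  push Not at hcon
  have hne : ε ≠ 0 := hε.ne'
  have h3 : ε * (1 + E s₀ / ε) = ε + E s₀ := by
    field_simp
  have h4 : ε * (1 + E s₀ / ε) ≤ E s * (1 + (s - s₀) / 4) :=
    mul_le_mul hcon (by linarith) (by linarith) (hE0 s)
  linarith

end Summit.NavierStokesRegularity.NavierStokesRegularity.Theorems.NoSelfExcitedDynamo.Registered

end
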